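import Literature.NumberTheory.LFunctions.Zhang2022.ToolkitGCShortIntervals
import Literature.NumberTheory.LFunctions.Zhang2022.Section8Lemma84Coeff
import HarnessLib

/-!
# Zhang (2022) §12: the log-free twisted sum of the middle range — from two logarithmic Riesz
# means to the sharp sum, and the short window (Shiu)

Topic `Literature/NumberTheory/LFunctions/Zhang2022` (Landau–Siegel audit tree; verdict-neutral).
Y. Zhang, *Discrete mean estimates and the Landau–Siegel zero*, arXiv:2211.02515v1 (2022)
[Zhang2022LandauSiegel] — **an unrefereed manuscript under adjudication; nothing here asserts or
denies its Theorems 1–2, and no claim about Landau–Siegel zeros is made.** Lane ZHANG-L (strike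
seat zl-closer-3), leaf `Typed.Sec12C.Mid1225 c′` via the log-free sum LF of
`Typed.Sec12C.mid1225_of_logfree` (§12 p.71; (12.11) p.70 has no proof in print, tex L3549).

Two elementary pieces of the log-free argument (companions of `Section12LogFreeContour`,
`Section12LogFreeCore`):

* `norm_sum_Ico_le_of_riesz` — for ANY `f : ℕ → ℂ` and `1 ≤ Y′ < Y`, with `h = log Y − log Y′` and
  the logarithmic Riesz means `R(x) = Σ_{n≤x} f(n)log(x/n)`:
  `‖Σ_{1≤n<Y} f(n)‖ ≤ ‖R(Y) − R(Y′)‖/h + 2Σ_{⌊Y′⌋<n≤⌊Y⌋}‖f(n)‖` (exact bookkeeping: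
  `R(Y) − R(Y′) = hΣ_{n≤Y′}f(n) + Σ_{Y′<n≤Y}f(n)log(Y/n)` and `0 ≤ log(Y/n) ≤ h` on the window);
* `window_xiZero_le` — the window for the manuscript's coefficients
  `|χ(n)ξ₀ⱼ(n;d,r)n^{β_μ−1}| ≤ gC(n)/n` (`XiZeroMajorant.norm_xiZero_le_gC`), so that Shiu's theorem
  in the tree's packaging `XiZeroMajorant.gC_shortLogMean_Ioc` (prime bound `gC(p) ≤ 5 + (60+7M₀)/p`,
  exponent `5`) gives `Σ_{⌊Y′⌋<n≤⌊Y⌋} gC(n)/n ≤ C·e^{60+7M₀}·((Y−Y′)/Y′)·(log Y′)⁴` for `Y′ ≥ x₀`,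
  `Y′ + Y′^{1/4} ≤ Y ≤ 2Y′`, uniformly in `c′, D, d, r, j`.

Theorems only; no new definitions, no facts; standard axioms.

## References

* Y. Zhang, arXiv:2211.02515v1 (2022), §12 (12.11) p.70; §7 p.33 (`ξ₀ⱼ`).
  [cite: Zhang2022LandauSiegel, §12 (12.11) p.70; §7 Prop. 7.1 p.33]
* P. Shiu, J. reine angew. Math. 313 (1980), 161–170, Theorem 1. [cite: Shiu1980, Theorem 1]
-/

noncomputable section

open Complex Real Finset

namespace Literature.NumberTheory.LFunctions.Zhang2022.Lemma84

open Skeleton XiZeroMajorant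

/-! ### From two logarithmic Riesz means to the sharp sum -/

/-- **Sharp sum from two logarithmic Riesz means.** For `f : ℕ → ℂ`, `1 ≤ Y′ < Y`,
`h = log Y − log Y′`: `‖Σ_{1≤n<Y} f(n)‖ ≤ ‖R(Y) − R(Y′)‖/h + 2Σ_{⌊Y′⌋<n≤⌊Y⌋}‖f(n)‖` where
`R(x) = Σ_{n≤x} f(n)log(x/n)` — since `R(Y) − R(Y′) = hΣ_{n≤Y′} f(n) + Σ_{Y′<n≤Y} f(n)log(Y/n)` with
`0 ≤ log(Y/n) ≤ h` there, and `Σ_{n<Y} f − Σ_{n≤Y′} f` is a sub-window sum.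
[cite: Zhang2022LandauSiegel, §12 (12.11) p.70] [cite: MontgomeryVaughan2007, §5.1] -/
theorem norm_sum_Ico_le_of_riesz (f : ℕ → ℂ) {Y Y' : ℝ} (hY' : 1 ≤ Y') (hYY' : Y' < Y) :
    ‖∑ n ∈ Finset.Ico 1 ⌈Y⌉₊, f n‖ ≤
      ‖(∑ n ∈ Finset.Ioc 0 ⌊Y⌋₊, f n * (Real.log (Y / n) : ℂ)) -
          ∑ n ∈ Finset.Ioc 0 ⌊Y'⌋₊, f n * (Real.log (Y' / n) : ℂ)‖ / (Real.log Y - Real.log Y') +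
        2 * ∑ n ∈ Finset.Ioc ⌊Y'⌋₊ ⌊Y⌋₊, ‖f n‖ := by
  have hY'0 : 0 < Y' := by linarith
  have hY0 : 0 < Y := by linarith
  set h : ℝ := Real.log Y - Real.log Y' with hh
  have hh0 : 0 < h := by rw [hh]; linarith [Real.log_lt_log hY'0 hYY']
  have hfl : ⌊Y'⌋₊ ≤ ⌊Y⌋₊ := Nat.floor_le_floor hYY'.le
  -- the three index sets
  set A := Finset.Ioc 0 ⌊Y'⌋₊ with hA
  set W := Finset.Ioc ⌊Y'⌋₊ ⌊Y⌋₊ with hW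
  set S := Finset.Ico 1 ⌈Y⌉₊ with hS
  have hAW : Disjoint A W := by
    rw [hA, hW, Finset.disjoint_left]
    intro n hn hn'
    rw [Finset.mem_Ioc] at hn hn'
    omega
  have hAWu : A ∪ W = Finset.Ioc 0 ⌊Y⌋₊ := by
    rw [hA, hW]; exact Finset.Ioc_union_Ioc_eq_Ioc (Nat.zero_le _) hfl
  have hAS : A ⊆ S := by
    intro n hn
    rw [hA, Finset.mem_Ioc] at hn
    rw [hS, Finset.mem_Ico]
    refine ⟨hn.1, Nat.lt_ceil.2 ?_⟩
    calc (n : ℝ) ≤ ⌊Y'⌋₊ := by exact_mod_cast hn.2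
      _ ≤ Y' := Nat.floor_le hY'0.le
      _ < Y := hYY'
  have hSAW : S \ A ⊆ W := by
    intro n hn
    rw [Finset.mem_sdiff, hS, hA, Finset.mem_Ico, Finset.mem_Ioc] at hn
    rw [hW, Finset.mem_Ioc]
    obtain ⟨⟨h1, h2⟩, h3⟩ := hn
    have h4 : (n : ℝ) < Y := Nat.lt_ceil.1 h2
    refine ⟨by omega, Nat.le_floor h4.le⟩
  -- window facts: `0 ≤ log(Y/n) ≤ h` for `n ∈ W`
  have hlogW : ∀ n ∈ W, 0 ≤ Real.log (Y / n) ∧ Real.log (Y / n) ≤ h := by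
    intro n hn
    rw [hW, Finset.mem_Ioc] at hn
    have hn1 : Y' < n := by
      have := Nat.lt_of_floor_lt hn.1
      exact this
    have hn0 : (0 : ℝ) < n := lt_trans hY'0 hn1
    have hn2 : (n : ℝ) ≤ Y := by
      calc (n : ℝ) ≤ ⌊Y⌋₊ := by exact_mod_cast hn.2
        _ ≤ Y := Nat.floor_le hY0.le
    constructor
    · exact Real.log_nonneg ((one_le_div hn0).2 hn2)
    · rw [Real.log_div hY0.ne' hn0.ne', hh]
      linarith [Real.log_le_log hY'0 hn1.le]
  -- `R(Y) − R(Y') = h·Σ_A f + Σ_W f log(Y/n)`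
  have hRY : (∑ n ∈ Finset.Ioc 0 ⌊Y⌋₊, f n * (Real.log (Y / n) : ℂ)) =
      (∑ n ∈ A, f n * (Real.log (Y / n) : ℂ)) + ∑ n ∈ W, f n * (Real.log (Y / n) : ℂ) := by
    rw [← hAWu, Finset.sum_union hAW]
  have hRA : (∑ n ∈ A, f n * (Real.log (Y / n) : ℂ)) - ∑ n ∈ A, f n * (Real.log (Y' / n) : ℂ) =
      (h : ℂ) * ∑ n ∈ A, f n := by
    rw [← Finset.sum_sub_distrib, Finset.mul_sum]
    refine Finset.sum_congr rfl fun n hn => ?_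
    rw [hA, Finset.mem_Ioc] at hn
    have hn0 : (0 : ℝ) < n := by exact_mod_cast hn.1
    rw [Real.log_div hY0.ne' hn0.ne', Real.log_div hY'0.ne' hn0.ne', hh]
    push_cast
    ring
  have hdiff : (∑ n ∈ Finset.Ioc 0 ⌊Y⌋₊, f n * (Real.log (Y / n) : ℂ)) -
      (∑ n ∈ Finset.Ioc 0 ⌊Y'⌋₊, f n * (Real.log (Y' / n) : ℂ)) =
      (h : ℂ) * (∑ n ∈ A, f n) + ∑ n ∈ W, f n * (Real.log (Y / n) : ℂ) := by
    rw [hRY, ← hA, ← hRA]; ring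
  -- `Σ_S f = Σ_A f + Σ_{S\A} f`
  have hSf : ∑ n ∈ S, f n = (∑ n ∈ A, f n) + ∑ n ∈ S \ A, f n := by
    rw [← Finset.sum_sdiff hAS]; ring
  -- norms
  have hW1 : ‖∑ n ∈ W, f n * (Real.log (Y / n) : ℂ)‖ ≤ h * ∑ n ∈ W, ‖f n‖ := by
    rw [Finset.mul_sum]
    refine (norm_sum_le _ _).trans (Finset.sum_le_sum fun n hn => ?_)
    obtain ⟨h1, h2⟩ := hlogW n hn
    rw [norm_mul, Complex.norm_real, Real.norm_of_nonneg h1, mul_comm]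
    exact mul_le_mul_of_nonneg_right h2 (norm_nonneg _)
  have hW2 : ‖∑ n ∈ S \ A, f n‖ ≤ ∑ n ∈ W, ‖f n‖ :=
    (norm_sum_le _ _).trans (Finset.sum_le_sum_of_subset_of_nonneg hSAW fun _ _ _ => norm_nonneg _)
  have hAf : ‖∑ n ∈ A, f n‖ ≤
      (‖(∑ n ∈ Finset.Ioc 0 ⌊Y⌋₊, f n * (Real.log (Y / n) : ℂ)) -
          ∑ n ∈ Finset.Ioc 0 ⌊Y'⌋₊, f n * (Real.log (Y' / n) : ℂ)‖ + h * ∑ n ∈ W, ‖f n‖) / h := by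
    rw [le_div_iff₀ hh0, hdiff]
    have hn : ‖(h : ℂ) * ∑ n ∈ A, f n‖ = ‖∑ n ∈ A, f n‖ * h := by
      rw [norm_mul, Complex.norm_real, Real.norm_of_nonneg hh0.le, mul_comm]
    calc ‖∑ n ∈ A, f n‖ * h = ‖(h : ℂ) * ∑ n ∈ A, f n‖ := hn.symm
      _ = ‖((h : ℂ) * (∑ n ∈ A, f n) + ∑ n ∈ W, f n * (Real.log (Y / n) : ℂ)) -
            ∑ n ∈ W, f n * (Real.log (Y / n) : ℂ)‖ := by rw [add_sub_cancel_right]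
      _ ≤ ‖(h : ℂ) * (∑ n ∈ A, f n) + ∑ n ∈ W, f n * (Real.log (Y / n) : ℂ)‖ +
            ‖∑ n ∈ W, f n * (Real.log (Y / n) : ℂ)‖ := norm_sub_le _ _
      _ ≤ _ := by linarith [hW1]
  have hsum0 : 0 ≤ ∑ n ∈ W, ‖f n‖ := Finset.sum_nonneg fun _ _ => norm_nonneg _
  rw [hSf]
  calc ‖(∑ n ∈ A, f n) + ∑ n ∈ S \ A, f n‖ ≤ ‖∑ n ∈ A, f n‖ + ‖∑ n ∈ S \ A, f n‖ := norm_add_le _ _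
    _ ≤ (‖(∑ n ∈ Finset.Ioc 0 ⌊Y⌋₊, f n * (Real.log (Y / n) : ℂ)) -
          ∑ n ∈ Finset.Ioc 0 ⌊Y'⌋₊, f n * (Real.log (Y' / n) : ℂ)‖ + h * ∑ n ∈ W, ‖f n‖) / h +
        ∑ n ∈ W, ‖f n‖ := add_le_add hAf hW2
    _ = _ := by field_simp; ring

/-! ### The window for the manuscript's coefficients -/

section Window

variable (c' : ℝ) {D : ℕ} (χ : DirichletCharacter ℂ D)

/-- `|χ(n)ξ₀ⱼ(n;d,r)n^{β_μ−1}| ≤ gC(n)/n` for `n ≥ 1` (`|χ| ≤ 1`, `Re β_μ = 0`,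
`|ξ₀ⱼ| ≤ gC`). [cite: Zhang2022LandauSiegel, §7 p.33] -/
theorem norm_coeff_le_gC_div (j μ d r : ℕ) {n : ℕ} (hn : n ≠ 0) :
    ‖χ (n : ZMod D) * xiZero c' D j n d r * (n : ℂ) ^ (betaMu D μ - 1)‖ ≤ gC c' D n / n := by
  have hn0 : 0 < n := Nat.pos_of_ne_zero hn
  rw [norm_mul, norm_mul, Complex.norm_natCast_cpow_of_pos hn0, sub_re, betaMu_re, one_re, zero_sub,
    Real.rpow_neg_one, div_eq_mul_inv]
  have hχ := χ.norm_le_one (n : ZMod D)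
  have hξ := norm_xiZero_le_gC c' D hn j d r
  have hg0 := gC_nonneg c' D n
  calc ‖χ (n : ZMod D)‖ * ‖xiZero c' D j n d r‖ * (n : ℝ)⁻¹ ≤ 1 * gC c' D n * (n : ℝ)⁻¹ := by
        gcongr
    _ = gC c' D n * (n : ℝ)⁻¹ := by ring

/-- **The short window (Shiu).** There are absolute `C ≥ 0`, `x₀ ≥ 2` such that for all `c′, D, χ,
j, μ, d, r` and `x₀ ≤ Y′`, `Y′ + Y′^{1/4} ≤ Y ≤ 2Y′`:
`Σ_{⌊Y′⌋<n≤⌊Y⌋} |χ(n)ξ₀ⱼ(n;d,r)n^{β_μ−1}| ≤ C·((Y − Y′)/Y′)·(log Y′)⁴`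
(`gC_shortLogMean_Ioc` with the crude prime bound `gC(p) ≤ 5 + (60+7M₀)/p`).
[cite: Zhang2022LandauSiegel, §7 Prop. 7.1 p.33] [cite: Shiu1980, Theorem 1] -/
theorem window_xiZero_le :
    ∃ C x₀ : ℝ, 0 ≤ C ∧ 2 ≤ x₀ ∧ ∀ (c' : ℝ) (D : ℕ) (χ : DirichletCharacter ℂ D) (j μ d r : ℕ)
      (Y Y' : ℝ), x₀ ≤ Y' → Y' + Y' ^ (1 / 4 : ℝ) ≤ Y → Y ≤ 2 * Y' →
        ∑ n ∈ Finset.Ioc ⌊Y'⌋₊ ⌊Y⌋₊,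
            ‖χ (n : ZMod D) * xiZero c' D j n d r * (n : ℂ) ^ (betaMu D μ - 1)‖ ≤
          C * ((Y - Y') / Y') * Real.log Y' ^ 4 := by
  obtain ⟨C, x₀, hC0, hx₀, h⟩ := gC_shortLogMean_Ioc 5
  have hM0 := M0_nonneg
  refine ⟨C * Real.exp (60 + 7 * M0), x₀, by positivity, hx₀,
    fun c' D χ j μ d r Y Y' hY' hYY' hY2 => ?_⟩
  have hfp : ∀ p : ℕ, p.Prime → (p : ℝ) ≤ Y' →
      gC c' D p ≤ (5 : ℕ) + 0 * Real.log p + (60 + 7 * M0) / p := by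
    intro p hp _
    have := gC_prime_le c' D hp
    push_cast
    linarith
  have key := h c' D 0 (60 + 7 * M0) le_rfl (by positivity) Y' Y hY' hYY' hY2 hfp
  rw [zero_mul, zero_add] at key
  have hY'2 : 2 ≤ Y' := le_trans hx₀ hY'
  have hlog1 : 0 < Real.log Y' := Real.log_pos (by linarith)
  have hle : ∑ n ∈ Finset.Ioc ⌊Y'⌋₊ ⌊Y⌋₊,
      ‖χ (n : ZMod D) * xiZero c' D j n d r * (n : ℂ) ^ (betaMu D μ - 1)‖ ≤
      ∑ n ∈ Finset.Ioc ⌊Y'⌋₊ ⌊Y⌋₊, gC c' D n / n := by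
    refine Finset.sum_le_sum fun n hn => norm_coeff_le_gC_div c' χ j μ d r ?_
    rw [Finset.mem_Ioc] at hn
    have : 2 ≤ ⌊Y'⌋₊ := Nat.le_floor (by exact_mod_cast hY'2)
    omega
  refine hle.trans (key.trans (le_of_eq ?_))
  rw [div_eq_iff hlog1.ne']
  ring

end Window

end Literature.NumberTheory.LFunctions.Zhang2022.Lemma84
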